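import Summits.CriticalPhenomena.PercolationContinuityZ3.Theorems.PercNearOneGluingNoHeavyLowerTailKnQuestion8CoefficientwiseCoreClassKernelMixChordedClassScheme
import Summits.CriticalPhenomena.PercolationContinuityZ3.Theorems.PercNearOneGluingNoHeavyLowerTailKnQuestion8CoefficientwiseCoreClassKernelMixBundleClassChain
import HarnessLib

/-!
# Chorded bundles, III: the CLASS THEOREM — every red-prefix class of `Θ(ℓ_z,ℓ_x,ℓ_y,1)` is self-sufficient with its own supply points and joins

Support file (`--supports stmt-CriticalPhenomena-4575`, closed), prover `prim-cplus-coupling` (gen 60).  No definitions, no notations, no named facts,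
no sorries; standard axioms.  Memo `prim-cplus-coupling/A5-COUPLING-gen60.md` §1.

SETTING.  An explicit bundle whose threads are exactly `z, x, y, c` with `L c = 1` (the chord `u b`): the UNIT-THREAD BASE `Θ(ℓ₀,ℓ₁,ℓ₂,1)` of the lane's
CONJECTURE IET (with THEOREM A of gen 53 it governs every bundle with at most three long threads).  Levels `{0,1}`-valued monotone, `𝒱` any up-closed event,
`R_a(z)` the red-prefix class of `z` (`1 ≤ a ≤ L z − 1`); `bad₁ = hro ∧ kbo`, `bad₂ = kro ∧ hbo`, `L₁, L₂` the landing statuses, `P₁` the joins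
(`demand ∧ hᵃX = kᵃX = 1 ∧ hᵇY = kᵇY = 0`).
* `Coefficientwise.bundle_chorded_class_count` (CLASS THEOREM): `#bad₁(𝒱 ∩ R_a(z)) + #bad₂(𝒱 ∩ R_a(z)) ≤ #((L₁∪L₂)(𝒱) ∩ R_a(z)) + #(P₁(𝒱) ∩ R_a(z))`.
PROOF.  FACES: the class sources dark on `x` have pairwise comparable red clusters (`bundle_class_chain`, the chord being blue in every demand point), so they
carry one type; likewise for `y`.  Hence each of `x, y` may be prefix-frozen for at least one type, and `bundle_class_scheme_count` (…ChordedClassScheme) runs for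
each type on the HONEST event `𝒱 ∧ (above a type-i source of the class)` — which counts the same sources.  A common landing of the two schemes lies above a
source of each type, is fully red on no thread (class on `z`, freezes on `x, y`), and contains the chord; removing the chord edge gives a demand point of the
class above both sources, i.e. a join in `P₁(𝒱) ∩ R_a(z)`, injectively.  So `#bad₁ + #bad₂ ≤ #M₁ + #M₂ = #(M₁∪M₂) + #(M₁∩M₂) ≤ #(L₁∪L₂) + #P₁` inside the
class.  (The supply targets alone do NOT suffice — exact counterexamples in the memo; the joins are needed.)  Exact SAT cross-check for all 0/1 levels and
all up-sets on Θ(1,2,3,3), Θ(1,3,3,3), Θ(1,2,3,4) (kit j237488, variants RAP).  [cite: KozmaNitzan2024, Questions 8–9 (§5.5 p. 36) (context); Harris 1960]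
-/

namespace Summit.CriticalPhenomena.PercolationContinuityZ3.Theorems

open Finset Literature.Probability.Percolation

namespace Coefficientwise

variable {ι V : Type*}

open Classical in
/-- **CLASS THEOREM for chorded bundles `Θ(ℓ_z, ℓ_x, ℓ_y, 1)` (all 0/1 levels, every up-set).**  On an explicit bundle whose threads are exactly
`z, x, y, c` (pairwise distinct) with `L c = 1` (the chord), for every red-prefix class `R_a(z)` (`1 ≤ a`, `a + 1 ≤ L z`):
`#bad₁(𝒱 ∩ R_a(z)) + #bad₂(𝒱 ∩ R_a(z)) ≤ #((L₁ ∪ L₂)(𝒱) ∩ R_a(z)) + #(P₁(𝒱) ∩ R_a(z))`.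
PROOF: the sources of the class that are dark on `x` (resp. `y`) have pairwise comparable red clusters (`bundle_class_chain`), so they carry one type; hence
each of `x, y` can be prefix-frozen for at least one type; the two fibre schemes `bundle_class_scheme_count` run on the honest events
`𝒱 ∧ (above a type-i source)`; a common landing is non-full on `z, x, y`, contains the chord, and with the chord removed is a join in `P₁(𝒱) ∩ R_a(z)`,
injectively.  Memo gen 60 §1.  [cite: KozmaNitzan2024, Questions 8–9 (§5.5 p. 36) (context); Harris 1960] -/
theorem bundle_chorded_class_count (ends : ι → Sym2 V) (r : ℕ) (L : ℕ → ℕ) (hL : ∀ t, t < r → 1 ≤ L t)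
    (w : ℕ → ℕ → V) (e : ℕ → ℕ → ι) (u b : V)
    (hw0 : ∀ t, t < r → w t 0 = u) (hwL : ∀ t, t < r → w t (L t) = b)
    (harc : ∀ t, t < r → ∀ j, 1 ≤ j → j ≤ L t → ends (e t j) = s(w t (j - 1), w t j))
    (hwinj : ∀ t, t < r → ∀ i j, i ≤ L t → j ≤ L t → w t i = w t j → i = j)
    (hcross : ∀ t t', t < r → t' < r → t ≠ t' → ∀ i j, i ≤ L t → j ≤ L t' → w t i = w t' j → (i = 0 ∧ j = 0) ∨ (i = L t ∧ j = L t'))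
    (A : ℕ → Finset ι) (hA : ∀ t, t < r → ∀ i, i ∈ A t ↔ ∃ j, 1 ≤ j ∧ j ≤ L t ∧ e t j = i)
    (hAdisj : ∀ t t', t < r → t' < r → t ≠ t' → Disjoint (A t) (A t'))
    (E : Finset ι) (hEA : ∀ i, i ∈ E ↔ ∃ t, t < r ∧ i ∈ A t)
    (z x y c : ℕ) (hz : z < r) (hx : x < r) (hy : y < r) (hc : c < r)
    (hzx : z ≠ x) (hzy : z ≠ y) (hzc : z ≠ c) (hxy : x ≠ y) (hxc : x ≠ c) (hyc : y ≠ c)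
    (hr4 : ∀ t, t < r → t = z ∨ t = x ∨ t = y ∨ t = c) (hLc : L c = 1)
    (a : ℕ) (ha1 : 1 ≤ a) (haL : a + 1 ≤ L z)
    (𝒱 : Finset ι → Prop) (hV : ∀ ⦃s t : Finset ι⦄, s ⊆ t → 𝒱 s → 𝒱 t)
    (ha hb ka kb : Set V → ℝ) (mha : Monotone ha) (mhb : Monotone hb) (mka : Monotone ka) (mkb : Monotone kb)
    (ha01 : ∀ S, ha S = 0 ∨ ha S = 1) (hb01 : ∀ S, hb S = 0 ∨ hb S = 1) (ka01 : ∀ S, ka S = 0 ∨ ka S = 1) (kb01 : ∀ S, kb S = 0 ∨ kb S = 1) :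
    ((E.powerset).filter (fun σ => ((∀ j, 1 ≤ j → j ≤ a → e z j ∈ σ) ∧ e z (a + 1) ∉ σ) ∧ 𝒱 σ ∧
        (b ∈ openCluster (ends '' (↑(E \ σ) : Set ι)) u ∧ b ∉ openCluster (ends '' (↑σ : Set ι)) u) ∧
        (ha (openCluster (ends '' (↑σ : Set ι)) u) = 1 ∧ hb (openCluster (ends '' (↑(E \ σ) : Set ι)) u) = 0) ∧
        (kb (openCluster (ends '' (↑(E \ σ) : Set ι)) u) = 1 ∧ ka (openCluster (ends '' (↑σ : Set ι)) u) = 0))).card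
    + ((E.powerset).filter (fun σ => ((∀ j, 1 ≤ j → j ≤ a → e z j ∈ σ) ∧ e z (a + 1) ∉ σ) ∧ 𝒱 σ ∧
        (b ∈ openCluster (ends '' (↑(E \ σ) : Set ι)) u ∧ b ∉ openCluster (ends '' (↑σ : Set ι)) u) ∧
        (ka (openCluster (ends '' (↑σ : Set ι)) u) = 1 ∧ kb (openCluster (ends '' (↑(E \ σ) : Set ι)) u) = 0) ∧
        (hb (openCluster (ends '' (↑(E \ σ) : Set ι)) u) = 1 ∧ ha (openCluster (ends '' (↑σ : Set ι)) u) = 0))).card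
    ≤ ((E.powerset).filter (fun lam => ((∀ j, 1 ≤ j → j ≤ a → e z j ∈ lam) ∧ e z (a + 1) ∉ lam) ∧ 𝒱 lam ∧
        (b ∈ openCluster (ends '' (↑lam : Set ι)) u ∧ b ∉ openCluster (ends '' (↑(E \ lam) : Set ι)) u) ∧
        ((ha (openCluster (ends '' (↑lam : Set ι)) u) = 1 ∧ kb (openCluster (ends '' (↑lam : Set ι)) u) = 1 ∧
            hb (openCluster (ends '' (↑(E \ lam) : Set ι)) u) = 0 ∧ ka (openCluster (ends '' (↑(E \ lam) : Set ι)) u) = 0) ∨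
          (ka (openCluster (ends '' (↑lam : Set ι)) u) = 1 ∧ hb (openCluster (ends '' (↑lam : Set ι)) u) = 1 ∧
            kb (openCluster (ends '' (↑(E \ lam) : Set ι)) u) = 0 ∧ ha (openCluster (ends '' (↑(E \ lam) : Set ι)) u) = 0)))).card
    + ((E.powerset).filter (fun σ => ((∀ j, 1 ≤ j → j ≤ a → e z j ∈ σ) ∧ e z (a + 1) ∉ σ) ∧ 𝒱 σ ∧
        (b ∈ openCluster (ends '' (↑(E \ σ) : Set ι)) u ∧ b ∉ openCluster (ends '' (↑σ : Set ι)) u) ∧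
        (ha (openCluster (ends '' (↑σ : Set ι)) u) = 1 ∧ ka (openCluster (ends '' (↑σ : Set ι)) u) = 1 ∧
          hb (openCluster (ends '' (↑(E \ σ) : Set ι)) u) = 0 ∧ kb (openCluster (ends '' (↑(E \ σ) : Set ι)) u) = 0))).card := by
  set C : Finset ι → Set V := fun ω => openCluster (ends '' (↑ω : Set ι)) u with hC
  -- ## bundle bookkeeping
  have hr : 0 < r := lt_of_le_of_lt (Nat.zero_le c) hc
  have hAE : ∀ t, t < r → A t ⊆ E := fun t ht i hi => (hEA i).mpr ⟨t, ht, hi⟩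
  have heA : ∀ t, t < r → ∀ j, 1 ≤ j → j ≤ L t → e t j ∈ A t := fun t ht j hj1 hjL => (hA t ht _).mpr ⟨j, hj1, hjL, rfl⟩
  have hE : ∀ i, i ∈ E → ∃ t, t < r ∧ ∃ j, 1 ≤ j ∧ j ≤ L t ∧ e t j = i := by
    intro i hi
    obtain ⟨t, ht, hit⟩ := (hEA i).mp hi
    exact ⟨t, ht, (hA t ht i).mp hit⟩
  have full_iff : ∀ ω : Finset ι, ω ⊆ E → (b ∈ C ω ↔ ∃ t, t < r ∧ A t ⊆ ω) := fun ω hω =>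
    bundle_b_mem_cluster_iff_threads ends r L hL w e u b hr hw0 hwL harc hwinj hcross A hA E hEA ω hω
  have hAc : A c = {e c 1} := by
    ext i
    rw [hA c hc i, Finset.mem_singleton]
    constructor
    · rintro ⟨j, hj1, hjL, rfl⟩
      have : j = 1 := by rw [hLc] at hjL; omega
      rw [this]
    · intro hi; exact ⟨1, le_refl 1, by rw [hLc], hi.symm⟩
  have hecE : e c 1 ∈ E := hAE c hc (heA c hc 1 (le_refl 1) (by rw [hLc]))
  -- 0/1 bookkeeping
  have one_of_ge : ∀ (f : Set V → ℝ), (∀ S, f S = 0 ∨ f S = 1) → ∀ S S' : Set V, S ⊆ S' → Monotone f → f S = 1 → f S' = 1 := by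
    intro f f01 S S' hSS' mf h1
    rcases f01 S' with h0 | h0
    · have := mf hSS'; rw [h1, h0] at this; linarith
    · exact h0
  have zero_of_le : ∀ (f : Set V → ℝ), (∀ S, f S = 0 ∨ f S = 1) → ∀ S S' : Set V, S ⊆ S' → Monotone f → f S' = 0 → f S = 0 := by
    intro f f01 S S' hSS' mf h0
    rcases f01 S with h1 | h1
    · exact h1
    · have := mf hSS'; rw [h1, h0] at this; linarith
  have Cmono : ∀ s t : Finset ι, s ⊆ t → C s ⊆ C t := fun s t hst => openCluster_image_mono ends hst u
  have Ccompl : ∀ s t : Finset ι, s ⊆ t → C (E \ t) ⊆ C (E \ s) := fun s t hst => Cmono _ _ (Finset.sdiff_subset_sdiff (le_refl E) hst)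
  -- demand points miss the chord and have no full thread; supply points contain the chord
  have src_no_chord : ∀ σ : Finset ι, σ ⊆ E → (b ∈ C (E \ σ) ∧ b ∉ C σ) → e c 1 ∉ σ := by
    intro σ hσ hN hm
    exact hN.2 ((full_iff σ hσ).mpr ⟨c, hc, by rw [hAc]; exact Finset.singleton_subset_iff.mpr hm⟩)
  have src_nf : ∀ σ : Finset ι, σ ⊆ E → (b ∈ C (E \ σ) ∧ b ∉ C σ) → ∀ t, t < r → ∃ j, 1 ≤ j ∧ j ≤ L t ∧ e t j ∉ σ := by
    intro σ hσ hN t ht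
    by_contra hno
    push Not at hno
    exact hN.2 ((full_iff σ hσ).mpr ⟨t, ht, fun i hi => by
      obtain ⟨j, hj1, hjL, rfl⟩ := (hA t ht i).mp hi
      exact hno j hj1 hjL⟩)
  have supply_chord : ∀ lam : Finset ι, lam ⊆ E → (b ∈ C lam ∧ b ∉ C (E \ lam)) → e c 1 ∈ lam := by
    intro lam hlam hR
    by_contra hm
    exact hR.2 ((full_iff (E \ lam) Finset.sdiff_subset).mpr ⟨c, hc, by
      rw [hAc]; exact Finset.singleton_subset_iff.mpr (Finset.mem_sdiff.mpr ⟨hecE, hm⟩)⟩)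
  -- ## sources of the class and the honest events
  obtain ⟨cls, hcls⟩ : ∃ f : Finset ι → Prop, f = fun ω => (∀ j, 1 ≤ j → j ≤ a → e z j ∈ ω) ∧ e z (a + 1) ∉ ω := ⟨_, rfl⟩
  obtain ⟨src₁, hsrc₁⟩ : ∃ f : Finset ι → Prop, f = fun σ => σ ⊆ E ∧ cls σ ∧ 𝒱 σ ∧ (b ∈ C (E \ σ) ∧ b ∉ C σ) ∧
      (ha (C σ) = 1 ∧ hb (C (E \ σ)) = 0) ∧ (kb (C (E \ σ)) = 1 ∧ ka (C σ) = 0) := ⟨_, rfl⟩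
  obtain ⟨src₂, hsrc₂⟩ : ∃ f : Finset ι → Prop, f = fun σ => σ ⊆ E ∧ cls σ ∧ 𝒱 σ ∧ (b ∈ C (E \ σ) ∧ b ∉ C σ) ∧
      (ka (C σ) = 1 ∧ kb (C (E \ σ)) = 0) ∧ (hb (C (E \ σ)) = 1 ∧ ha (C σ) = 0) := ⟨_, rfl⟩
  obtain ⟨𝒱₁, hV₁⟩ : ∃ f : Finset ι → Prop, f = fun ξ => 𝒱 ξ ∧ ∃ σ, σ ⊆ ξ ∧ src₁ σ := ⟨_, rfl⟩
  obtain ⟨𝒱₂, hV₂⟩ : ∃ f : Finset ι → Prop, f = fun ξ => 𝒱 ξ ∧ ∃ σ, σ ⊆ ξ ∧ src₂ σ := ⟨_, rfl⟩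
  have hV₁mono : ∀ ⦃s t : Finset ι⦄, s ⊆ t → 𝒱₁ s → 𝒱₁ t := by
    intro s t hst hs; rw [hV₁] at hs ⊢
    obtain ⟨hv, σ, hσs, hσ⟩ := hs
    exact ⟨hV hst hv, σ, hσs.trans hst, hσ⟩
  have hV₂mono : ∀ ⦃s t : Finset ι⦄, s ⊆ t → 𝒱₂ s → 𝒱₂ t := by
    intro s t hst hs; rw [hV₂] at hs ⊢
    obtain ⟨hv, σ, hσs, hσ⟩ := hs
    exact ⟨hV hst hv, σ, hσs.trans hst, hσ⟩
  -- ## the face lemma: sources of different types cannot both be dark on `d ∈ {x, y}`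
  have face : ∀ (o d : ℕ), o < r → o ≠ z → (∀ t, t < r → t ≠ z → t ≠ o → t = d ∨ t = c) →
      ∀ σ₁ σ₂ : Finset ι, src₁ σ₁ → src₂ σ₂ → e d 1 ∉ σ₁ → e d 1 ∉ σ₂ → False := by
    intro o d ho hoz hrest σ₁ σ₂ hs₁ hs₂ hd₁ hd₂
    rw [hsrc₁] at hs₁; rw [hsrc₂] at hs₂
    obtain ⟨hσ₁E, hcl₁, -, hN₁, hh₁, hk₁⟩ := hs₁
    obtain ⟨hσ₂E, hcl₂, -, hN₂, hh₂, hk₂⟩ := hs₂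
    rw [hcls] at hcl₁ hcl₂
    have hstart : ∀ σ : Finset ι, σ ⊆ E → (b ∈ C (E \ σ) ∧ b ∉ C σ) → e d 1 ∉ σ → ∀ t, t < r → t ≠ z → t ≠ o → e t 1 ∉ σ := by
      intro σ hσ hN hdσ t ht htz hto
      rcases hrest t ht htz hto with h | h
      · rw [h]; exact hdσ
      · rw [h]; exact src_no_chord σ hσ hN
    have key := bundle_class_chain ends r L w e u hw0 harc hwinj hcross E hE z o a σ₁ σ₂ hσ₁E hσ₂E
      (src_nf σ₁ hσ₁E hN₁) (src_nf σ₂ hσ₂E hN₂) hcl₁ hcl₂ (hstart σ₁ hσ₁E hN₁ hd₁) (hstart σ₂ hσ₂E hN₂ hd₂)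
    rcases key with h12 | h21
    · have h1 := one_of_ge ha ha01 _ _ h12 mha hh₁.1
      rw [hk₂.2] at h1; norm_num at h1
    · have h1 := one_of_ge ka ka01 _ _ h21 mka hh₂.1
      rw [hk₁.2] at h1; norm_num at h1
  have facex := face y x hy hzy.symm (fun t ht htz hty => by
    rcases hr4 t ht with h | h | h | h
    · exact absurd h htz
    · exact Or.inl h
    · exact absurd h hty
    · exact Or.inr h)
  have facey := face x y hx hzx.symm (fun t ht htz htx => by
    rcases hr4 t ht with h | h | h | h
    · exact absurd h htz
    · exact absurd h htx
    · exact Or.inl h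
    · exact Or.inr h)
  -- ## the freezes: type i freezes `x` iff it has no `x`-dark source in the class (likewise `y`)
  obtain ⟨dx₁, hdx₁⟩ : ∃ P : Prop, P = ∃ σ, src₁ σ ∧ e x 1 ∉ σ := ⟨_, rfl⟩
  obtain ⟨dx₂, hdx₂⟩ : ∃ P : Prop, P = ∃ σ, src₂ σ ∧ e x 1 ∉ σ := ⟨_, rfl⟩
  obtain ⟨dy₁, hdy₁⟩ : ∃ P : Prop, P = ∃ σ, src₁ σ ∧ e y 1 ∉ σ := ⟨_, rfl⟩
  obtain ⟨dy₂, hdy₂⟩ : ∃ P : Prop, P = ∃ σ, src₂ σ ∧ e y 1 ∉ σ := ⟨_, rfl⟩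
  have nandx : ¬ (dx₁ ∧ dx₂) := by
    rw [hdx₁, hdx₂]; rintro ⟨⟨σ₁, hs₁, h₁⟩, ⟨σ₂, hs₂, h₂⟩⟩; exact facex σ₁ σ₂ hs₁ hs₂ h₁ h₂
  have nandy : ¬ (dy₁ ∧ dy₂) := by
    rw [hdy₁, hdy₂]; rintro ⟨⟨σ₁, hs₁, h₁⟩, ⟨σ₂, hs₂, h₂⟩⟩; exact facey σ₁ σ₂ hs₁ hs₂ h₁ h₂
  obtain ⟨SX₁, hSX₁⟩ : ∃ S : Finset ℕ, S = if dx₁ then {0} else Finset.Icc 1 (L x - 1) := ⟨_, rfl⟩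
  obtain ⟨SX₂, hSX₂⟩ : ∃ S : Finset ℕ, S = if dx₂ then {0} else Finset.Icc 1 (L x - 1) := ⟨_, rfl⟩
  obtain ⟨SY₁, hSY₁⟩ : ∃ S : Finset ℕ, S = if dy₁ then {0} else Finset.Icc 1 (L y - 1) := ⟨_, rfl⟩
  obtain ⟨SY₂, hSY₂⟩ : ∃ S : Finset ℕ, S = if dy₂ then {0} else Finset.Icc 1 (L y - 1) := ⟨_, rfl⟩
  have zero_ne_Icc : ∀ n : ℕ, ({0} : Finset ℕ) ≠ Finset.Icc 1 n := by
    intro n h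
    have : (0 : ℕ) ∈ Finset.Icc 1 n := by rw [← h]; exact Finset.mem_singleton_self 0
    rw [Finset.mem_Icc] at this; omega
  have flag_cases : ∀ (S : Finset ℕ) (P : Prop) (n : ℕ), S = (if P then {0} else Finset.Icc 1 n) →
      (S = {0} ∨ S = Finset.Icc 1 n) ∧ (S = Finset.Icc 1 n → ¬ P) ∧ (¬ P → S = Finset.Icc 1 n) := by
    intro S P n hS
    by_cases hP : P
    · rw [if_pos hP] at hS
      exact ⟨Or.inl hS, fun h => absurd (hS.symm.trans h) (zero_ne_Icc n), fun h => absurd hP h⟩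
    · rw [if_neg hP] at hS
      exact ⟨Or.inr hS, fun _ => hP, fun _ => hS⟩
  obtain ⟨hSX₁', frX₁, unX₁⟩ := flag_cases SX₁ dx₁ (L x - 1) hSX₁
  obtain ⟨hSX₂', frX₂, unX₂⟩ := flag_cases SX₂ dx₂ (L x - 1) hSX₂
  obtain ⟨hSY₁', frY₁, unY₁⟩ := flag_cases SY₁ dy₁ (L y - 1) hSY₁
  obtain ⟨hSY₂', frY₂, unY₂⟩ := flag_cases SY₂ dy₂ (L y - 1) hSY₂
  have hallx : SX₁ = Finset.Icc 1 (L x - 1) ∨ SX₂ = Finset.Icc 1 (L x - 1) := by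
    by_cases h : dx₁
    · exact Or.inr (unX₂ fun h2 => nandx ⟨h, h2⟩)
    · exact Or.inl (unX₁ h)
  have hally : SY₁ = Finset.Icc 1 (L y - 1) ∨ SY₂ = Finset.Icc 1 (L y - 1) := by
    by_cases h : dy₁
    · exact Or.inr (unY₂ fun h2 => nandy ⟨h, h2⟩)
    · exact Or.inl (unY₁ h)
  -- a counted honest source IS a class source of its type
  have src₁_of : ∀ σ, σ ⊆ E → ((∀ j, 1 ≤ j → j ≤ a → e z j ∈ σ) ∧ e z (a + 1) ∉ σ) →
      (𝒱₁ σ ∧ (b ∈ C (E \ σ) ∧ b ∉ C σ) ∧ (ha (C σ) = 1 ∧ hb (C (E \ σ)) = 0) ∧ (kb (C (E \ σ)) = 1 ∧ ka (C σ) = 0)) → src₁ σ := by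
    intro σ hσ hcl hs
    rw [hV₁] at hs; rw [hsrc₁]
    exact ⟨hσ, by rw [hcls]; exact hcl, hs.1.1, hs.2.1, hs.2.2.1, hs.2.2.2⟩
  have src₂_of : ∀ σ, σ ⊆ E → ((∀ j, 1 ≤ j → j ≤ a → e z j ∈ σ) ∧ e z (a + 1) ∉ σ) →
      (𝒱₂ σ ∧ (b ∈ C (E \ σ) ∧ b ∉ C σ) ∧ (ka (C σ) = 1 ∧ kb (C (E \ σ)) = 0) ∧ (hb (C (E \ σ)) = 1 ∧ ha (C σ) = 0)) → src₂ σ := by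
    intro σ hσ hcl hs
    rw [hV₂] at hs; rw [hsrc₂]
    exact ⟨hσ, by rw [hcls]; exact hcl, hs.1.1, hs.2.1, hs.2.2.1, hs.2.2.2⟩
  have cov₁X : SX₁ = Finset.Icc 1 (L x - 1) → ∀ σ, σ ⊆ E → ((∀ j, 1 ≤ j → j ≤ a → e z j ∈ σ) ∧ e z (a + 1) ∉ σ) →
      (𝒱₁ σ ∧ (b ∈ C (E \ σ) ∧ b ∉ C σ) ∧ (ha (C σ) = 1 ∧ hb (C (E \ σ)) = 0) ∧ (kb (C (E \ σ)) = 1 ∧ ka (C σ) = 0)) → e x 1 ∈ σ := by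
    intro hS σ hσ hcl hs
    by_contra hm
    exact frX₁ hS (by rw [hdx₁]; exact ⟨σ, src₁_of σ hσ hcl hs, hm⟩)
  have cov₁Y : SY₁ = Finset.Icc 1 (L y - 1) → ∀ σ, σ ⊆ E → ((∀ j, 1 ≤ j → j ≤ a → e z j ∈ σ) ∧ e z (a + 1) ∉ σ) →
      (𝒱₁ σ ∧ (b ∈ C (E \ σ) ∧ b ∉ C σ) ∧ (ha (C σ) = 1 ∧ hb (C (E \ σ)) = 0) ∧ (kb (C (E \ σ)) = 1 ∧ ka (C σ) = 0)) → e y 1 ∈ σ := by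
    intro hS σ hσ hcl hs
    by_contra hm
    exact frY₁ hS (by rw [hdy₁]; exact ⟨σ, src₁_of σ hσ hcl hs, hm⟩)
  have cov₂X : SX₂ = Finset.Icc 1 (L x - 1) → ∀ σ, σ ⊆ E → ((∀ j, 1 ≤ j → j ≤ a → e z j ∈ σ) ∧ e z (a + 1) ∉ σ) →
      (𝒱₂ σ ∧ (b ∈ C (E \ σ) ∧ b ∉ C σ) ∧ (ka (C σ) = 1 ∧ kb (C (E \ σ)) = 0) ∧ (hb (C (E \ σ)) = 1 ∧ ha (C σ) = 0)) → e x 1 ∈ σ := by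
    intro hS σ hσ hcl hs
    by_contra hm
    exact frX₂ hS (by rw [hdx₂]; exact ⟨σ, src₂_of σ hσ hcl hs, hm⟩)
  have cov₂Y : SY₂ = Finset.Icc 1 (L y - 1) → ∀ σ, σ ⊆ E → ((∀ j, 1 ≤ j → j ≤ a → e z j ∈ σ) ∧ e z (a + 1) ∉ σ) →
      (𝒱₂ σ ∧ (b ∈ C (E \ σ) ∧ b ∉ C σ) ∧ (ka (C σ) = 1 ∧ kb (C (E \ σ)) = 0) ∧ (hb (C (E \ σ)) = 1 ∧ ha (C σ) = 0)) → e y 1 ∈ σ := by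
    intro hS σ hσ hcl hs
    by_contra hm
    exact frY₂ hS (by rw [hdy₂]; exact ⟨σ, src₂_of σ hσ hcl hs, hm⟩)
  -- ## the two fibre schemes on the honest events
  have k₁ := bundle_class_scheme_count ends r L hL w e u b hw0 hwL harc hwinj hcross A hA hAdisj E hEA z x y hz hx hy hzx hzy hxy a ha1 haL
    𝒱₁ hV₁mono ha hb ka kb mha mhb mka mkb ha01 hb01 ka01 kb01 SX₁ SY₁ hSX₁' hSY₁' cov₁X cov₁Y
  have k₂ := bundle_class_scheme_count ends r L hL w e u b hw0 hwL harc hwinj hcross A hA hAdisj E hEA z x y hz hx hy hzx hzy hxy a ha1 haL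
    𝒱₂ hV₂mono ka kb ha hb mka mkb mha mhb ka01 kb01 ha01 hb01 SX₂ SY₂ hSX₂' hSY₂' cov₂X cov₂Y
  set M₁ : Finset (Finset ι) := (E.powerset).filter (fun lam => ((∀ j, 1 ≤ j → j ≤ a → e z j ∈ lam) ∧ e z (a + 1) ∉ lam) ∧ 𝒱₁ lam ∧
        (b ∈ C lam ∧ b ∉ C (E \ lam)) ∧ (ha (C lam) = 1 ∧ kb (C lam) = 1 ∧ hb (C (E \ lam)) = 0 ∧ ka (C (E \ lam)) = 0) ∧
        (SX₁ = Finset.Icc 1 (L x - 1) → e x 1 ∈ lam ∧ ¬ A x ⊆ lam) ∧ (SY₁ = Finset.Icc 1 (L y - 1) → e y 1 ∈ lam ∧ ¬ A y ⊆ lam)) with hM₁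
  set M₂ : Finset (Finset ι) := (E.powerset).filter (fun lam => ((∀ j, 1 ≤ j → j ≤ a → e z j ∈ lam) ∧ e z (a + 1) ∉ lam) ∧ 𝒱₂ lam ∧
        (b ∈ C lam ∧ b ∉ C (E \ lam)) ∧ (ka (C lam) = 1 ∧ hb (C lam) = 1 ∧ kb (C (E \ lam)) = 0 ∧ ha (C (E \ lam)) = 0) ∧
        (SX₂ = Finset.Icc 1 (L x - 1) → e x 1 ∈ lam ∧ ¬ A x ⊆ lam) ∧ (SY₂ = Finset.Icc 1 (L y - 1) → e y 1 ∈ lam ∧ ¬ A y ⊆ lam)) with hM₂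
  -- ## the honest events count the same sources
  have e₁ : (E.powerset).filter (fun σ => ((∀ j, 1 ≤ j → j ≤ a → e z j ∈ σ) ∧ e z (a + 1) ∉ σ) ∧ 𝒱 σ ∧ (b ∈ C (E \ σ) ∧ b ∉ C σ) ∧
      (ha (C σ) = 1 ∧ hb (C (E \ σ)) = 0) ∧ (kb (C (E \ σ)) = 1 ∧ ka (C σ) = 0)) =
      (E.powerset).filter (fun σ => ((∀ j, 1 ≤ j → j ≤ a → e z j ∈ σ) ∧ e z (a + 1) ∉ σ) ∧ 𝒱₁ σ ∧ (b ∈ C (E \ σ) ∧ b ∉ C σ) ∧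
      (ha (C σ) = 1 ∧ hb (C (E \ σ)) = 0) ∧ (kb (C (E \ σ)) = 1 ∧ ka (C σ) = 0)) := by
    apply Finset.filter_congr
    intro σ hσ
    rw [Finset.mem_powerset] at hσ
    constructor
    · rintro ⟨hcl, hv, hN, hh, hk⟩
      refine ⟨hcl, ?_, hN, hh, hk⟩
      rw [hV₁]; exact ⟨hv, σ, le_refl σ, by rw [hsrc₁]; exact ⟨hσ, by rw [hcls]; exact hcl, hv, hN, hh, hk⟩⟩
    · rintro ⟨hcl, hv, hN, hh, hk⟩
      rw [hV₁] at hv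
      exact ⟨hcl, hv.1, hN, hh, hk⟩
  have e₂ : (E.powerset).filter (fun σ => ((∀ j, 1 ≤ j → j ≤ a → e z j ∈ σ) ∧ e z (a + 1) ∉ σ) ∧ 𝒱 σ ∧ (b ∈ C (E \ σ) ∧ b ∉ C σ) ∧
      (ka (C σ) = 1 ∧ kb (C (E \ σ)) = 0) ∧ (hb (C (E \ σ)) = 1 ∧ ha (C σ) = 0)) =
      (E.powerset).filter (fun σ => ((∀ j, 1 ≤ j → j ≤ a → e z j ∈ σ) ∧ e z (a + 1) ∉ σ) ∧ 𝒱₂ σ ∧ (b ∈ C (E \ σ) ∧ b ∉ C σ) ∧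
      (ka (C σ) = 1 ∧ kb (C (E \ σ)) = 0) ∧ (hb (C (E \ σ)) = 1 ∧ ha (C σ) = 0)) := by
    apply Finset.filter_congr
    intro σ hσ
    rw [Finset.mem_powerset] at hσ
    constructor
    · rintro ⟨hcl, hv, hN, hh, hk⟩
      refine ⟨hcl, ?_, hN, hh, hk⟩
      rw [hV₂]; exact ⟨hv, σ, le_refl σ, by rw [hsrc₂]; exact ⟨hσ, by rw [hcls]; exact hcl, hv, hN, hh, hk⟩⟩
    · rintro ⟨hcl, hv, hN, hh, hk⟩
      rw [hV₂] at hv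
      exact ⟨hcl, hv.1, hN, hh, hk⟩
  have b₁ : ((E.powerset).filter (fun σ => ((∀ j, 1 ≤ j → j ≤ a → e z j ∈ σ) ∧ e z (a + 1) ∉ σ) ∧ 𝒱 σ ∧ (b ∈ C (E \ σ) ∧ b ∉ C σ) ∧
      (ha (C σ) = 1 ∧ hb (C (E \ σ)) = 0) ∧ (kb (C (E \ σ)) = 1 ∧ ka (C σ) = 0))).card ≤ M₁.card := by rw [e₁]; convert k₁ using 3
  have b₂ : ((E.powerset).filter (fun σ => ((∀ j, 1 ≤ j → j ≤ a → e z j ∈ σ) ∧ e z (a + 1) ∉ σ) ∧ 𝒱 σ ∧ (b ∈ C (E \ σ) ∧ b ∉ C σ) ∧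
      (ka (C σ) = 1 ∧ kb (C (E \ σ)) = 0) ∧ (hb (C (E \ σ)) = 1 ∧ ha (C σ) = 0))).card ≤ M₂.card := by rw [e₂]; convert k₂ using 3
  -- ## landings are (L₁ ∪ L₂)-targets of 𝒱 in the class
  set T : Finset (Finset ι) := (E.powerset).filter (fun lam => ((∀ j, 1 ≤ j → j ≤ a → e z j ∈ lam) ∧ e z (a + 1) ∉ lam) ∧ 𝒱 lam ∧
      (b ∈ C lam ∧ b ∉ C (E \ lam)) ∧
      ((ha (C lam) = 1 ∧ kb (C lam) = 1 ∧ hb (C (E \ lam)) = 0 ∧ ka (C (E \ lam)) = 0) ∨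
        (ka (C lam) = 1 ∧ hb (C lam) = 1 ∧ kb (C (E \ lam)) = 0 ∧ ha (C (E \ lam)) = 0))) with hT
  have hsub : M₁ ∪ M₂ ⊆ T := by
    intro lam hlam
    rcases Finset.mem_union.mp hlam with h | h
    · rw [hM₁, Finset.mem_filter] at h
      have hv : 𝒱 lam := by have h1 := h.2.2.1; rw [hV₁] at h1; exact h1.1
      exact Finset.mem_filter.mpr ⟨h.1, h.2.1, hv, h.2.2.2.1, Or.inl h.2.2.2.2.1⟩
    · rw [hM₂, Finset.mem_filter] at h
      have hv : 𝒱 lam := by have h1 := h.2.2.1; rw [hV₂] at h1; exact h1.1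
      exact Finset.mem_filter.mpr ⟨h.1, h.2.1, hv, h.2.2.2.1, Or.inr h.2.2.2.2.1⟩
  -- ## a common landing, with the chord removed, is a join in P₁(𝒱) in the class
  set P : Finset (Finset ι) := (E.powerset).filter (fun σ => ((∀ j, 1 ≤ j → j ≤ a → e z j ∈ σ) ∧ e z (a + 1) ∉ σ) ∧ 𝒱 σ ∧
      (b ∈ C (E \ σ) ∧ b ∉ C σ) ∧ (ha (C σ) = 1 ∧ ka (C σ) = 1 ∧ hb (C (E \ σ)) = 0 ∧ kb (C (E \ σ)) = 0)) with hP
  have hzc1 : e z (a + 1) ≠ e c 1 := fun h =>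
    Finset.disjoint_left.mp (hAdisj z c hz hc hzc) (heA z hz (a + 1) (by omega) haL) (by rw [h, hAc]; exact Finset.mem_singleton_self _)
  have join : ∀ lam, lam ∈ M₁ ∩ M₂ → lam \ A c ∈ P := by
    intro lam hlam
    obtain ⟨h1, h2⟩ := Finset.mem_inter.mp hlam
    rw [hM₁, Finset.mem_filter, Finset.mem_powerset] at h1
    rw [hM₂, Finset.mem_filter, Finset.mem_powerset] at h2
    obtain ⟨hlamE, hcl, hv1, hR, -, f1X, f1Y⟩ := h1
    obtain ⟨-, -, hv2, -, -, f2X, f2Y⟩ := h2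
    rw [hV₁] at hv1; rw [hV₂] at hv2
    obtain ⟨hv, σ₁, hσ₁lam, hs₁⟩ := hv1
    obtain ⟨-, σ₂, hσ₂lam, hs₂⟩ := hv2
    rw [hsrc₁] at hs₁; rw [hsrc₂] at hs₂
    obtain ⟨hσ₁E, -, hvσ₁, hN₁, hh₁, hk₁⟩ := hs₁
    obtain ⟨hσ₂E, -, hvσ₂, hN₂, hh₂, hk₂⟩ := hs₂
    set ι' : Finset ι := lam \ A c with hι'
    have hι'E : ι' ⊆ E := Finset.sdiff_subset.trans hlamE
    have hσ₁ι : σ₁ ⊆ ι' := fun i hi => Finset.mem_sdiff.mpr ⟨hσ₁lam hi, fun hic => by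
      rw [hAc, Finset.mem_singleton] at hic; subst hic; exact src_no_chord σ₁ hσ₁E hN₁ hi⟩
    have hσ₂ι : σ₂ ⊆ ι' := fun i hi => Finset.mem_sdiff.mpr ⟨hσ₂lam hi, fun hic => by
      rw [hAc, Finset.mem_singleton] at hic; subst hic; exact src_no_chord σ₂ hσ₂E hN₂ hi⟩
    have hclι : (∀ j, 1 ≤ j → j ≤ a → e z j ∈ ι') ∧ e z (a + 1) ∉ ι' := by
      refine ⟨fun j hj1 hja => Finset.mem_sdiff.mpr ⟨hcl.1 j hj1 hja, fun hm => ?_⟩, fun hm => hcl.2 (Finset.mem_sdiff.mp hm).1⟩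
      exact Finset.disjoint_left.mp (hAdisj z c hz hc hzc) (heA z hz j hj1 (by omega)) hm
    have hbY : b ∈ C (E \ ι') := (full_iff (E \ ι') Finset.sdiff_subset).mpr ⟨c, hc, by
      rw [hAc]; exact Finset.singleton_subset_iff.mpr (Finset.mem_sdiff.mpr ⟨hecE, fun hm => (Finset.mem_sdiff.mp hm).2 (by
        rw [hAc]; exact Finset.mem_singleton_self _)⟩)⟩
    have hbX : b ∉ C ι' := by
      intro hm
      obtain ⟨t, ht, hsubt⟩ := (full_iff ι' hι'E).mp hm
      have hsub' : A t ⊆ lam := hsubt.trans Finset.sdiff_subset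
      rcases hr4 t ht with h | h | h | h
      · subst h; exact hcl.2 (hsub' (heA t ht (a + 1) (by omega) haL))
      · subst h
        rcases hallx with hS | hS
        · exact (f1X hS).2 hsub'
        · exact (f2X hS).2 hsub'
      · subst h
        rcases hally with hS | hS
        · exact (f1Y hS).2 hsub'
        · exact (f2Y hS).2 hsub'
      · subst h
        have : e t 1 ∈ ι' := hsubt (by rw [hAc]; exact Finset.mem_singleton_self _)
        exact (Finset.mem_sdiff.mp this).2 (by rw [hAc]; exact Finset.mem_singleton_self _)
    have hXa : ha (C ι') = 1 := one_of_ge ha ha01 _ _ (Cmono σ₁ ι' hσ₁ι) mha hh₁.1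
    have hXk : ka (C ι') = 1 := one_of_ge ka ka01 _ _ (Cmono σ₂ ι' hσ₂ι) mka hh₂.1
    have hYb : hb (C (E \ ι')) = 0 := zero_of_le hb hb01 _ _ (Ccompl σ₁ ι' hσ₁ι) mhb hh₁.2
    have hYk : kb (C (E \ ι')) = 0 := zero_of_le kb kb01 _ _ (Ccompl σ₂ ι' hσ₂ι) mkb hh₂.2
    rw [hP, Finset.mem_filter, Finset.mem_powerset]
    exact ⟨hι'E, hclι, hV hσ₁ι hvσ₁, ⟨hbY, hbX⟩, hXa, hXk, hYb, hYk⟩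
  have inj : Set.InjOn (fun lam : Finset ι => lam \ A c) ↑(M₁ ∩ M₂) := by
    intro lam hlam lam' hlam' heq
    have h1 := (Finset.mem_inter.mp (Finset.mem_coe.mp hlam)).1
    have h1' := (Finset.mem_inter.mp (Finset.mem_coe.mp hlam')).1
    rw [hM₁, Finset.mem_filter, Finset.mem_powerset] at h1 h1'
    have hc1 : A c ⊆ lam := by rw [hAc]; exact Finset.singleton_subset_iff.mpr (supply_chord lam h1.1 h1.2.2.2.1)
    have hc1' : A c ⊆ lam' := by rw [hAc]; exact Finset.singleton_subset_iff.mpr (supply_chord lam' h1'.1 h1'.2.2.2.1)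
    have := congrArg (fun s : Finset ι => s ∪ A c) heq
    simp only at this
    rwa [Finset.sdiff_union_of_subset hc1, Finset.sdiff_union_of_subset hc1'] at this
  have cP : (M₁ ∩ M₂).card ≤ P.card :=
    Finset.card_le_card_of_injOn (fun lam => lam \ A c) (fun lam hlam => join lam hlam) inj
  -- ## assembly
  have eU := Finset.card_union_add_card_inter M₁ M₂
  have cU := Finset.card_le_card hsub
  calc _ ≤ M₁.card + M₂.card := Nat.add_le_add b₁ b₂
    _ = (M₁ ∪ M₂).card + (M₁ ∩ M₂).card := eU.symm
    _ ≤ T.card + P.card := Nat.add_le_add cU cP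

end Coefficientwise

end Summit.CriticalPhenomena.PercolationContinuityZ3.Theorems
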